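import Summits.CriticalPhenomena.PercolationContinuityZ3.Theorems.PercNearOneGluingNoHeavyLowerTailKnQuestion8CoefficientwiseInGadget
import Literature.Computation.FiniteGraph.ReliabilityBridge
import Mathlib.Data.Fin.VecNotation
import HarnessLib

/-!
# The in-gadget inequality (IG) and the stratum monotonicity (CONJECTURE M) are FALSE — kernel-checked witnesses (prim-lf-2 gen 58)

Support file (`--supports stmt-CriticalPhenomena-4575`, closed), prover `prim-lf-2` (gen 58).  No named facts, no sorries; standard axioms; the arithmetic is
`decide +kernel` on a first-order two-colour recursion over the edge list (`cwRec`, `2¹⁰`–`2¹²` leaves).  Memo `prim-lf-2/CW-IGCEX-gen58.md`.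

prim-lf-2 gen 56 (`…CoefficientwiseInGadget.lean`, `noCore_of_inGadget`) reduced CONJECTURE NO-CORE to the in-gadget inequality
  (IG)  `0 ≤ Σ_{r ⊆ E_f : ∃ a ∈ S', y ∈ C_a(r ∪ B)} (f C_x(r ∪ B) − f C_x(E_f ∖ r))·(g C_x(r ∪ B) − g C_x(E_f ∖ r))`
(free edges `E_f` not meeting `y`, gadget `B`, `x ∈ S'`, `y ∉ S'`), census-clean on ≤ 7 vertices.  It is false on 8 vertices: take the two-lobe graph `LOBE(3,2)`
(root `x = 0` joined to `1,2,3,4,5`; paths `1–2–3`, `4–5`; hub `6 ∼ 3, 5`), a new vertex `y = 7` and the single gadget edge `B = {6–7}`, `E_f = E(LOBE(3,2))`, `S' = {x}`,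
`f = 1[1 ∈ ·]`, `g = 1[4 ∈ ·]`.  Since `y` is pendant, `y ∈ C_x(r ∪ B) ⟺ 6 ∈ C_x(r)` and the (IG) sum is prim-lf-2 gen 46's `REACH(6) = Σ_{6 ∈ C_x(r)} σ₁σ₄ = −1`.
Consequently the stratum `M({x}, q)` of the root-set stratification (hypothesis `hM` of `noCore_of_strata`, conclusion of `stratum_nonneg_of_inGadget`) is negative on
`LOBE(3,2) + 6–7 + 7–8` (`y = 7`, `q = 8` pendant at `y`): it equals `2·REACH(6) = −2`, while the NO-CORE sum of that graph is `40`.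
* `Coefficientwise.IGCex.cwRec`, `Coefficientwise.IGCex.cwRec_eq_sum` — EVALUATION BRIDGE: a two-colouring sum `Σ_{s ⊆ L} LEAF(R ∪ s, B ∪ (L ∖ s))` whose summand depends on the
  clusters only through finitely many memberships equals a first-order recursion over the edge list carrying the component labels of `Literature.Computation.FiniteGraph`
  (`addEdge`, `LabelsOK`, `cfgOf_cons_eq`), decidable by `decide +kernel` (reusable for any explicit coefficientwise evaluation).
* `Coefficientwise.IGCex.inGadget_sum_eq` — the (IG) sum of the witness is `−1`;  `Coefficientwise.IGCex.not_inGadget` — the hypothesis `hIG` of `noCore_of_inGadget` fails for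
  this `(ends, x, y)` and the monotone point functions `pt 1`, `pt 4`.
* `Coefficientwise.IGCex.stratum_sum_eq` (`= −2`), `Coefficientwise.IGCex.not_strata` — the hypothesis `hM` of `noCore_of_strata` fails on the 9-vertex witness;
  `Coefficientwise.IGCex.noCore_sum_eq` — its NO-CORE sum is `40` (CONJECTURE NO-CORE itself is not touched).
[cite: KozmaNitzan2024, Questions 8–9 (§5.5 p. 36) (context: the Question-8 pocket covariance programme)]
-/

namespace Summit.CriticalPhenomena.PercolationContinuityZ3.Theorems

open Finset Literature.Probability.Percolation Literature.Computation.FiniteGraph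

namespace Coefficientwise

namespace IGCex

/-! ### The evaluation bridge -/

/-- First-order two-colour recursion over an edge list: each edge is merged into the red labels or into the blue labels. [folklore] -/
def cwRec (leaf : List ℕ → List ℕ → ℤ) : List (ℕ × ℕ) → List ℕ → List ℕ → ℤ
  | [], lr, lb => leaf lr lb
  | e :: l, lr, lb => cwRec leaf l (addEdge lr e.1 e.2) lb + cwRec leaf l lr (addEdge lb e.1 e.2)

/-- Label test. [folklore] -/
def jl (lab : List ℕ) (a v : ℕ) : Bool := labelOf lab a == labelOf lab v

variable {k n : ℕ}

/-- The multigraph of an edge table `EL : Fin k → ℕ × ℕ` with entries `< n`. [folklore] -/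
def endsOf (EL : Fin k → ℕ × ℕ) (hEL : ∀ i, (EL i).1 < n ∧ (EL i).2 < n) (i : Fin k) : Sym2 (Fin n) :=
  s(⟨(EL i).1, (hEL i).1⟩, ⟨(EL i).2, (hEL i).2⟩)

/-- The LABELLING INVARIANT for an edge set `R` and a label list `lab` is the proposition
`∃ op, cfgOf n op = endsOf EL hEL '' ↑R ∧ LabelsOK n op lab` (some open-edge list with that configuration carries the labels); it holds initially.
[folklore] -/
theorem inv_empty (EL : Fin k → ℕ × ℕ) (hEL : ∀ i, (EL i).1 < n ∧ (EL i).2 < n) :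
    ∃ op : List (ℕ × ℕ), cfgOf n op = endsOf EL hEL '' (↑(∅ : Finset (Fin k)) : Set (Fin k)) ∧ LabelsOK n op (List.range n) := by
  refine ⟨[], ?_, labelsOK_range_nil n⟩
  ext e
  simp [cfgOf]

/-- The labelling invariant is preserved when one more edge is opened (`addEdge`). [folklore] -/
theorem inv_insert {EL : Fin k → ℕ × ℕ} {hEL : ∀ i, (EL i).1 < n ∧ (EL i).2 < n} {R : Finset (Fin k)} {lab : List ℕ}
    (h : ∃ op : List (ℕ × ℕ), cfgOf n op = endsOf EL hEL '' (↑R : Set (Fin k)) ∧ LabelsOK n op lab) (a : Fin k) :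
    ∃ op : List (ℕ × ℕ), cfgOf n op = endsOf EL hEL '' (↑(insert a R) : Set (Fin k)) ∧ LabelsOK n op (addEdge lab (EL a).1 (EL a).2) := by
  obtain ⟨op, hop, hL⟩ := h
  refine ⟨(((⟨(EL a).1, (hEL a).1⟩ : Fin n) : ℕ), ((⟨(EL a).2, (hEL a).2⟩ : Fin n) : ℕ)) :: op, ?_, hL.cons _ _⟩
  rw [cfgOf_cons_eq, hop, Finset.coe_insert, Set.image_insert_eq]
  rfl

/-- Under the labelling invariant, cluster membership is the label test. [folklore] -/
theorem mem_iff_of_inv {EL : Fin k → ℕ × ℕ} {hEL : ∀ i, (EL i).1 < n ∧ (EL i).2 < n} {R : Finset (Fin k)} {lab : List ℕ}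
    (h : ∃ op : List (ℕ × ℕ), cfgOf n op = endsOf EL hEL '' (↑R : Set (Fin k)) ∧ LabelsOK n op lab) (a v : Fin n) :
    v ∈ openCluster (endsOf EL hEL '' (↑R : Set (Fin k))) a ↔ jl lab a v = true := by
  obtain ⟨op, hop, hL⟩ := h
  rw [← hop, openCluster, Set.mem_setOf_eq, ← hL.2 a v, jl, beq_iff_eq]

/-- **Evaluation bridge.**  If the integer leaf function computes `LEAF R B` from any labels satisfying the invariant for `(R, B)`, then the recursion over the edge list
`l` equals `Σ_{s ⊆ l} LEAF(R ∪ s, B ∪ (l ∖ s))`. [folklore] -/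
theorem cwRec_eq_sum (EL : Fin k → ℕ × ℕ) (hEL : ∀ i, (EL i).1 < n ∧ (EL i).2 < n) (leaf : List ℕ → List ℕ → ℤ)
    (LEAF : Finset (Fin k) → Finset (Fin k) → ℝ)
    (HL : ∀ (R B : Finset (Fin k)) (labR labB : List ℕ),
      (∃ op : List (ℕ × ℕ), cfgOf n op = endsOf EL hEL '' (↑R : Set (Fin k)) ∧ LabelsOK n op labR) →
      (∃ op : List (ℕ × ℕ), cfgOf n op = endsOf EL hEL '' (↑B : Set (Fin k)) ∧ LabelsOK n op labB) → (leaf labR labB : ℝ) = LEAF R B) :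
    ∀ (l : List (Fin k)), l.Nodup → ∀ (R B : Finset (Fin k)) (labR labB : List ℕ),
      (∃ op : List (ℕ × ℕ), cfgOf n op = endsOf EL hEL '' (↑R : Set (Fin k)) ∧ LabelsOK n op labR) →
      (∃ op : List (ℕ × ℕ), cfgOf n op = endsOf EL hEL '' (↑B : Set (Fin k)) ∧ LabelsOK n op labB) →
      (cwRec leaf (l.map EL) labR labB : ℝ) = ∑ s ∈ l.toFinset.powerset, LEAF (R ∪ s) (B ∪ (l.toFinset \ s))
  | [], _, R, B, labR, labB, hR, hB => by
      simp only [List.map_nil, cwRec, List.toFinset_nil, Finset.powerset_empty, Finset.sum_singleton, Finset.union_empty,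
        Finset.sdiff_self]
      exact HL R B labR labB hR hB
  | a :: l, hnd, R, B, labR, labB, hR, hB => by
      obtain ⟨hal, hl⟩ := List.nodup_cons.mp hnd
      have haL : a ∉ l.toFinset := fun h => hal (List.mem_toFinset.mp h)
      have ihR := cwRec_eq_sum EL hEL leaf LEAF HL l hl (insert a R) B _ labB (inv_insert hR a) hB
      have ihB := cwRec_eq_sum EL hEL leaf LEAF HL l hl R (insert a B) labR _ hR (inv_insert hB a)
      simp only [List.map_cons, cwRec, Int.cast_add, List.toFinset_cons]
      rw [ihR, ihB, Finset.sum_powerset_insert haL, add_comm]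
      congr 1
      · refine Finset.sum_congr rfl fun t ht => ?_
        have hat : a ∉ t := fun h => haL (Finset.mem_powerset.mp ht h)
        rw [Finset.insert_sdiff_of_notMem _ hat, Finset.union_insert, Finset.insert_union]
      · refine Finset.sum_congr rfl fun t ht => ?_
        have htl : t ⊆ l.toFinset := Finset.mem_powerset.mp ht
        have h1 : R ∪ insert a t = insert a R ∪ t := by rw [Finset.union_insert, Finset.insert_union]
        have h2 : insert a l.toFinset \ insert a t = l.toFinset \ t := by
          ext i
          simp only [Finset.mem_sdiff, Finset.mem_insert, not_or]
          constructor
          · rintro ⟨hi | hi, hia, hit⟩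
            · exact absurd hi hia
            · exact ⟨hi, hit⟩
          · rintro ⟨hi, hit⟩
            exact ⟨Or.inr hi, fun h => haL (h ▸ hi), hit⟩
        rw [h1, h2]

/-- Indicator of `v ∈ A` as a real number (a monotone point function). [folklore] -/
noncomputable def pt (v : Fin n) (A : Set (Fin n)) : ℝ := by classical exact if v ∈ A then 1 else 0

/-- Point functions are monotone. [folklore] -/
theorem pt_monotone (v : Fin n) : Monotone (pt v) := by
  intro A B hAB
  unfold pt; split_ifs with h1 h2
  · exact le_rfl
  · exact absurd (hAB h1) h2
  · exact zero_le_one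
  · exact le_rfl

/-- A point function evaluated through a Boolean test. [folklore] -/
theorem pt_eq_of_iff {v : Fin n} {A : Set (Fin n)} {b : Bool} (h : v ∈ A ↔ b = true) : pt v A = if b then 1 else 0 := by
  unfold pt; by_cases hb : b = true
  · rw [if_pos (h.mpr hb), if_pos hb]
  · rw [if_neg (fun hv => hb (h.mp hv)), if_neg hb]

/-- A real indicator evaluated through a Boolean test. [folklore] -/
theorem ite_eq_of_iff {P : Prop} [Decidable P] {b : Bool} (h : P ↔ b = true) : (if P then (1 : ℝ) else 0) = if b then 1 else 0 := by
  by_cases hb : b = true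
  · rw [if_pos (h.mpr hb), if_pos hb]
  · rw [if_neg (fun hv => hb (h.mp hv)), if_neg hb]

/-- The common product leaf `[c]·(r₁ − b₁)(r₄ − b₄)` in `ℤ`. -/
def leafB (c r1 b1 r4 b4 : Bool) : ℤ :=
  (if c then 1 else 0) * (((if r1 then 1 else 0) - (if b1 then 1 else 0)) * ((if r4 then 1 else 0) - (if b4 then 1 else 0)))

/-- The integer product leaf, cast to `ℝ`. [folklore] -/
theorem leafB_cast (c r1 b1 r4 b4 : Bool) :
    (leafB c r1 b1 r4 b4 : ℝ) = (if c then (1 : ℝ) else 0) * (((if r1 then (1 : ℝ) else 0) - (if b1 then 1 else 0)) * ((if r4 then (1 : ℝ) else 0) - (if b4 then 1 else 0))) := by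
  cases c <;> cases r1 <;> cases b1 <;> cases r4 <;> cases b4 <;> simp [leafB]

/-! ### Witness 1: (IG) fails on `LOBE(3,2)` with a pendant gadget edge at the hub -/

/-- Edge table: `LOBE(3,2)` (indices `0–9`) and the gadget edge `6–7` (index `10`). -/
def EL₁ : Fin 11 → ℕ × ℕ := ![(0,1), (0,2), (0,3), (0,4), (0,5), (1,2), (2,3), (4,5), (6,3), (6,5), (6,7)]

/-- All entries of `EL₁` are vertices of `Fin 8`. -/
theorem hEL₁ : ∀ i, (EL₁ i).1 < 8 ∧ (EL₁ i).2 < 8 := by decide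

/-- The 8-vertex multigraph of witness 1. -/
def ends₁ : Fin 11 → Sym2 (Fin 8) := endsOf EL₁ hEL₁

/-- Free edges and gadget of witness 1. -/
def Ef₁ : Finset (Fin 11) := {0, 1, 2, 3, 4, 5, 6, 7, 8, 9}
/-- Gadget of witness 1 (the pendant edge `6–7`). -/
def Bg₁ : Finset (Fin 11) := {10}
/-- The free edges as a list (for the recursion). -/
def lEf₁ : List (Fin 11) := [0, 1, 2, 3, 4, 5, 6, 7, 8, 9]

/-- Integer leaf of the (IG) sum: `[7 ∈ K]·([1∈K] − [1∈K̄])([4∈K] − [4∈K̄])`. -/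
def leaf₁ (lr lb : List ℕ) : ℤ := leafB (jl lr 0 7) (jl lr 0 1) (jl lb 0 1) (jl lr 0 4) (jl lb 0 4)

/-- Kernel evaluation: the (IG) recursion of witness 1 is `−1`. -/
theorem cwRec₁ : cwRec leaf₁ (lEf₁.map EL₁) (addEdge (List.range 8) (EL₁ 10).1 (EL₁ 10).2) (List.range 8) = -1 := by
  decide +kernel

open Classical in
/-- Real leaf of the (IG) sum as a function of the red and blue edge sets. -/
noncomputable def LEAF₁ (R B : Finset (Fin 11)) : ℝ :=
  (if (7 : Fin 8) ∈ openCluster (ends₁ '' (↑R : Set (Fin 11))) 0 then (1 : ℝ) else 0) *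
    ((pt 1 (openCluster (ends₁ '' (↑R : Set (Fin 11))) 0) - pt 1 (openCluster (ends₁ '' (↑B : Set (Fin 11))) 0)) *
      (pt 4 (openCluster (ends₁ '' (↑R : Set (Fin 11))) 0) - pt 4 (openCluster (ends₁ '' (↑B : Set (Fin 11))) 0)))

open Classical in
/-- The integer leaf computes the real leaf of witness 1. -/
theorem HL₁ : ∀ (R B : Finset (Fin 11)) (labR labB : List ℕ),
    (∃ op : List (ℕ × ℕ), cfgOf 8 op = endsOf EL₁ hEL₁ '' (↑R : Set (Fin 11)) ∧ LabelsOK 8 op labR) →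
    (∃ op : List (ℕ × ℕ), cfgOf 8 op = endsOf EL₁ hEL₁ '' (↑B : Set (Fin 11)) ∧ LabelsOK 8 op labB) →
    (leaf₁ labR labB : ℝ) = LEAF₁ R B := by
  intro R B labR labB hR hB
  rw [leaf₁, leafB_cast, LEAF₁, ends₁, ite_eq_of_iff (mem_iff_of_inv hR 0 7), pt_eq_of_iff (mem_iff_of_inv hR 0 1), pt_eq_of_iff (mem_iff_of_inv hB 0 1),
    pt_eq_of_iff (mem_iff_of_inv hR 0 4), pt_eq_of_iff (mem_iff_of_inv hB 0 4)]
  rfl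

open Classical in
/-- **The (IG) sum of witness 1 is `−1`.** -/
theorem inGadget_sum_eq :
    (∑ r ∈ Ef₁.powerset.filter (fun r : Finset (Fin 11) => ∃ a ∈ ({0} : Finset (Fin 8)), (7 : Fin 8) ∈ openCluster (ends₁ '' (↑(r ∪ Bg₁) : Set (Fin 11))) a),
      (pt 1 (openCluster (ends₁ '' (↑(r ∪ Bg₁) : Set (Fin 11))) 0) - pt 1 (openCluster (ends₁ '' (↑(Ef₁ \ r) : Set (Fin 11))) 0)) *
        (pt 4 (openCluster (ends₁ '' (↑(r ∪ Bg₁) : Set (Fin 11))) 0) - pt 4 (openCluster (ends₁ '' (↑(Ef₁ \ r) : Set (Fin 11))) 0))) = -1 := by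
  have hinvR : ∃ op : List (ℕ × ℕ), cfgOf 8 op = endsOf EL₁ hEL₁ '' (↑Bg₁ : Set (Fin 11)) ∧ LabelsOK 8 op (addEdge (List.range 8) (EL₁ 10).1 (EL₁ 10).2) := by
    have h := inv_insert (inv_empty EL₁ hEL₁) 10
    rwa [Finset.insert_empty] at h
  have hbridge := cwRec_eq_sum EL₁ hEL₁ leaf₁ LEAF₁ HL₁ lEf₁ (by decide) Bg₁ ∅ _ _ hinvR (inv_empty EL₁ hEL₁)
  have hl : lEf₁.toFinset = Ef₁ := by decide
  rw [hl, cwRec₁] at hbridge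
  rw [Finset.sum_filter]
  have hsum : ∀ r ∈ Ef₁.powerset,
      (if (∃ a ∈ ({0} : Finset (Fin 8)), (7 : Fin 8) ∈ openCluster (ends₁ '' (↑(r ∪ Bg₁) : Set (Fin 11))) a) then
        (pt 1 (openCluster (ends₁ '' (↑(r ∪ Bg₁) : Set (Fin 11))) 0) - pt 1 (openCluster (ends₁ '' (↑(Ef₁ \ r) : Set (Fin 11))) 0)) *
          (pt 4 (openCluster (ends₁ '' (↑(r ∪ Bg₁) : Set (Fin 11))) 0) - pt 4 (openCluster (ends₁ '' (↑(Ef₁ \ r) : Set (Fin 11))) 0))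
        else 0) = LEAF₁ (Bg₁ ∪ r) (∅ ∪ (Ef₁ \ r)) := by
    intro r _
    simp only [Finset.mem_singleton, exists_eq_left, Finset.empty_union, Finset.union_comm Bg₁ r, LEAF₁]
    split_ifs <;> simp
  rw [Finset.sum_congr rfl hsum, ← hbridge]
  norm_num

open Classical in
/-- **(IG) is false**: the hypothesis `hIG` of `Coefficientwise.noCore_of_inGadget` fails for `ends₁`, `E = univ`, `x = 0`, `y = 7` and the monotone point functions
`f = pt 1`, `g = pt 4` (`pt_monotone`). -/
theorem not_inGadget :
    ¬ (∀ (Ef Bg : Finset (Fin 11)) (S' : Finset (Fin 8)), Ef ⊆ univ → Bg ⊆ univ → Disjoint Ef Bg → (0 : Fin 8) ∈ S' → (7 : Fin 8) ∉ S' →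
        (∀ i ∈ Ef, (7 : Fin 8) ∉ ends₁ i) →
      0 ≤ ∑ r ∈ Ef.powerset.filter (fun r : Finset (Fin 11) => ∃ a ∈ S', (7 : Fin 8) ∈ openCluster (ends₁ '' (↑(r ∪ Bg) : Set (Fin 11))) a),
        (pt 1 (openCluster (ends₁ '' (↑(r ∪ Bg) : Set (Fin 11))) 0) - pt 1 (openCluster (ends₁ '' (↑(Ef \ r) : Set (Fin 11))) 0)) *
          (pt 4 (openCluster (ends₁ '' (↑(r ∪ Bg) : Set (Fin 11))) 0) - pt 4 (openCluster (ends₁ '' (↑(Ef \ r) : Set (Fin 11))) 0))) := by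
  intro h
  have hdis : Disjoint Ef₁ Bg₁ := by decide
  have hfree : ∀ i ∈ Ef₁, (7 : Fin 8) ∉ ends₁ i := by decide
  have h0 := h Ef₁ Bg₁ {0} (subset_univ _) (subset_univ _) hdis (by decide) (by decide) hfree
  rw [inGadget_sum_eq] at h0
  linarith

/-! ### Witness 2: a negative stratum (CONJECTURE M fails) on `LOBE(3,2) + 6–7 + 7–8`, while NO-CORE holds there -/

/-- Edge table: `LOBE(3,2)`, then `6–7` (`y = 7` joined to the hub) and `7–8` (`q = 8` pendant at `y`). -/
def EL₂ : Fin 12 → ℕ × ℕ := ![(0,1), (0,2), (0,3), (0,4), (0,5), (1,2), (2,3), (4,5), (6,3), (6,5), (6,7), (7,8)]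

/-- All entries of `EL₂` are vertices of `Fin 9`. -/
theorem hEL₂ : ∀ i, (EL₂ i).1 < 9 ∧ (EL₂ i).2 < 9 := by decide

/-- The 9-vertex multigraph of witness 2. -/
def ends₂ : Fin 12 → Sym2 (Fin 9) := endsOf EL₂ hEL₂

/-- All twelve edges of witness 2 as a list (for the recursion). -/
def lE₂ : List (Fin 12) := [0, 1, 2, 3, 4, 5, 6, 7, 8, 9, 10, 11]

/-- Stratum leaf: `[¬(r₀₇ ∧ b₀₇) ∧ ((r₈₇ ∨ r₀₇) ∧ (b₈₇ ∨ b₀₇))]·(r₁ − b₁)(r₄ − b₄)`. -/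
def leaf₂ (lr lb : List ℕ) : ℤ :=
  leafB (!(jl lr 0 7 && jl lb 0 7) && ((jl lr 8 7 || jl lr 0 7) && (jl lb 8 7 || jl lb 0 7))) (jl lr 0 1) (jl lb 0 1) (jl lr 0 4) (jl lb 0 4)

/-- NO-CORE leaf: `[¬(r₀₇ ∧ b₀₇)]·(r₁ − b₁)(r₄ − b₄)`. -/
def leaf₃ (lr lb : List ℕ) : ℤ :=
  leafB (!(jl lr 0 7 && jl lb 0 7)) (jl lr 0 1) (jl lb 0 1) (jl lr 0 4) (jl lb 0 4)

/-- Kernel evaluation: the stratum recursion of witness 2 is `−2`. -/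
theorem cwRec₂ : cwRec leaf₂ (lE₂.map EL₂) (List.range 9) (List.range 9) = -2 := by
  decide +kernel

/-- Kernel evaluation: the NO-CORE recursion of witness 2 is `40`. -/
theorem cwRec₃ : cwRec leaf₃ (lE₂.map EL₂) (List.range 9) (List.range 9) = 40 := by
  decide +kernel

/-- The difference `T(s)` of witness 2 as a function of the red and blue edge sets. -/
noncomputable def T₂ (R B : Finset (Fin 12)) : ℝ :=
  (pt 1 (openCluster (ends₂ '' (↑R : Set (Fin 12))) 0) - pt 1 (openCluster (ends₂ '' (↑B : Set (Fin 12))) 0)) *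
    (pt 4 (openCluster (ends₂ '' (↑R : Set (Fin 12))) 0) - pt 4 (openCluster (ends₂ '' (↑B : Set (Fin 12))) 0))

open Classical in
/-- Real stratum leaf. -/
noncomputable def LEAF₂ (R B : Finset (Fin 12)) : ℝ :=
  (if ¬ ((7 : Fin 9) ∈ openCluster (ends₂ '' (↑R : Set (Fin 12))) 0 ∧ (7 : Fin 9) ∈ openCluster (ends₂ '' (↑B : Set (Fin 12))) 0) ∧
        (((7 : Fin 9) ∈ openCluster (ends₂ '' (↑R : Set (Fin 12))) 8 ∨ (7 : Fin 9) ∈ openCluster (ends₂ '' (↑R : Set (Fin 12))) 0) ∧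
          ((7 : Fin 9) ∈ openCluster (ends₂ '' (↑B : Set (Fin 12))) 8 ∨ (7 : Fin 9) ∈ openCluster (ends₂ '' (↑B : Set (Fin 12))) 0))
    then (1 : ℝ) else 0) * T₂ R B

open Classical in
/-- Real NO-CORE leaf. -/
noncomputable def LEAF₃ (R B : Finset (Fin 12)) : ℝ :=
  (if ¬ ((7 : Fin 9) ∈ openCluster (ends₂ '' (↑R : Set (Fin 12))) 0 ∧ (7 : Fin 9) ∈ openCluster (ends₂ '' (↑B : Set (Fin 12))) 0) then (1 : ℝ) else 0) * T₂ R B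

/-- Boolean form of the stratum predicate. [folklore] -/
theorem bool_str {A B C D : Prop} {a b c d : Bool} (ha : A ↔ a = true) (hb : B ↔ b = true) (hc : C ↔ c = true) (hd : D ↔ d = true) :
    (¬ (A ∧ B) ∧ ((C ∨ A) ∧ (D ∨ B))) ↔ (!(a && b) && ((c || a) && (d || b))) = true := by
  rw [ha, hb, hc, hd]; cases a <;> cases b <;> cases c <;> cases d <;> simp

/-- Boolean form of the no-core predicate. [folklore] -/
theorem bool_nc {A B : Prop} {a b : Bool} (ha : A ↔ a = true) (hb : B ↔ b = true) : (¬ (A ∧ B)) ↔ (!(a && b)) = true := by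
  rw [ha, hb]; cases a <;> cases b <;> simp

open Classical in
/-- The integer stratum leaf computes the real one. -/
theorem HL₂ : ∀ (R B : Finset (Fin 12)) (labR labB : List ℕ),
    (∃ op : List (ℕ × ℕ), cfgOf 9 op = endsOf EL₂ hEL₂ '' (↑R : Set (Fin 12)) ∧ LabelsOK 9 op labR) →
    (∃ op : List (ℕ × ℕ), cfgOf 9 op = endsOf EL₂ hEL₂ '' (↑B : Set (Fin 12)) ∧ LabelsOK 9 op labB) →
    (leaf₂ labR labB : ℝ) = LEAF₂ R B := by
  intro R B labR labB hR hB
  rw [leaf₂, leafB_cast, LEAF₂, T₂, ends₂, ite_eq_of_iff (bool_str (mem_iff_of_inv hR 0 7) (mem_iff_of_inv hB 0 7) (mem_iff_of_inv hR 8 7) (mem_iff_of_inv hB 8 7)),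
    pt_eq_of_iff (mem_iff_of_inv hR 0 1), pt_eq_of_iff (mem_iff_of_inv hB 0 1), pt_eq_of_iff (mem_iff_of_inv hR 0 4), pt_eq_of_iff (mem_iff_of_inv hB 0 4)]
  rfl

open Classical in
/-- The integer NO-CORE leaf computes the real one. -/
theorem HL₃ : ∀ (R B : Finset (Fin 12)) (labR labB : List ℕ),
    (∃ op : List (ℕ × ℕ), cfgOf 9 op = endsOf EL₂ hEL₂ '' (↑R : Set (Fin 12)) ∧ LabelsOK 9 op labR) →
    (∃ op : List (ℕ × ℕ), cfgOf 9 op = endsOf EL₂ hEL₂ '' (↑B : Set (Fin 12)) ∧ LabelsOK 9 op labB) →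
    (leaf₃ labR labB : ℝ) = LEAF₃ R B := by
  intro R B labR labB hR hB
  rw [leaf₃, leafB_cast, LEAF₃, T₂, ends₂, ite_eq_of_iff (bool_nc (mem_iff_of_inv hR 0 7) (mem_iff_of_inv hB 0 7)),
    pt_eq_of_iff (mem_iff_of_inv hR 0 1), pt_eq_of_iff (mem_iff_of_inv hB 0 1), pt_eq_of_iff (mem_iff_of_inv hR 0 4), pt_eq_of_iff (mem_iff_of_inv hB 0 4)]
  rfl

open Classical in
/-- **The stratum `M({x}, q)` of witness 2 is `−2`** (shape of the hypothesis `hM` of `noCore_of_strata` / conclusion of `stratum_nonneg_of_inGadget`, with `E = univ`,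
`x = 0`, `y = 7`, `S = {0}`, `q = 8`, `f = pt 1`, `g = pt 4`). -/
theorem stratum_sum_eq :
    (∑ s ∈ (univ : Finset (Fin 12)).powerset.filter (fun s : Finset (Fin 12) =>
          ¬ ((∃ a ∈ ({0} : Finset (Fin 9)), (7 : Fin 9) ∈ openCluster (ends₂ '' (↑s : Set (Fin 12))) a) ∧
              (∃ a ∈ ({0} : Finset (Fin 9)), (7 : Fin 9) ∈ openCluster (ends₂ '' (↑(univ \ s) : Set (Fin 12))) a)) ∧
            ((∃ a ∈ insert (8 : Fin 9) ({0} : Finset (Fin 9)), (7 : Fin 9) ∈ openCluster (ends₂ '' (↑s : Set (Fin 12))) a) ∧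
              (∃ a ∈ insert (8 : Fin 9) ({0} : Finset (Fin 9)), (7 : Fin 9) ∈ openCluster (ends₂ '' (↑(univ \ s) : Set (Fin 12))) a))),
      (pt 1 (openCluster (ends₂ '' (↑s : Set (Fin 12))) 0) - pt 1 (openCluster (ends₂ '' (↑(univ \ s) : Set (Fin 12))) 0)) *
        (pt 4 (openCluster (ends₂ '' (↑s : Set (Fin 12))) 0) - pt 4 (openCluster (ends₂ '' (↑(univ \ s) : Set (Fin 12))) 0))) = -2 := by
  have hbridge := cwRec_eq_sum EL₂ hEL₂ leaf₂ LEAF₂ HL₂ lE₂ (by decide) ∅ ∅ _ _ (inv_empty EL₂ hEL₂) (inv_empty EL₂ hEL₂)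
  have hl : lE₂.toFinset = (univ : Finset (Fin 12)) := by decide
  rw [hl, cwRec₂] at hbridge
  rw [Finset.sum_filter]
  have hsum : ∀ s ∈ (univ : Finset (Fin 12)).powerset,
      (if (¬ ((∃ a ∈ ({0} : Finset (Fin 9)), (7 : Fin 9) ∈ openCluster (ends₂ '' (↑s : Set (Fin 12))) a) ∧
              (∃ a ∈ ({0} : Finset (Fin 9)), (7 : Fin 9) ∈ openCluster (ends₂ '' (↑(univ \ s) : Set (Fin 12))) a)) ∧
            ((∃ a ∈ insert (8 : Fin 9) ({0} : Finset (Fin 9)), (7 : Fin 9) ∈ openCluster (ends₂ '' (↑s : Set (Fin 12))) a) ∧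
              (∃ a ∈ insert (8 : Fin 9) ({0} : Finset (Fin 9)), (7 : Fin 9) ∈ openCluster (ends₂ '' (↑(univ \ s) : Set (Fin 12))) a))) then
        (pt 1 (openCluster (ends₂ '' (↑s : Set (Fin 12))) 0) - pt 1 (openCluster (ends₂ '' (↑(univ \ s) : Set (Fin 12))) 0)) *
          (pt 4 (openCluster (ends₂ '' (↑s : Set (Fin 12))) 0) - pt 4 (openCluster (ends₂ '' (↑(univ \ s) : Set (Fin 12))) 0))
        else 0) = LEAF₂ (∅ ∪ s) (∅ ∪ (univ \ s)) := by
    intro s _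
    simp only [Finset.mem_singleton, exists_eq_left, Finset.mem_insert, exists_eq_or_imp, Finset.empty_union, LEAF₂, T₂]
    split_ifs <;> simp
  rw [Finset.sum_congr rfl hsum, ← hbridge]
  norm_num

open Classical in
/-- **CONJECTURE M is false**: the hypothesis `hM` of `Coefficientwise.noCore_of_strata` fails for `ends₂`, `E = univ`, `x = 0`, `y = 7`, `f = pt 1`, `g = pt 4`. -/
theorem not_strata :
    ¬ (∀ (S : Finset (Fin 9)), (0 : Fin 9) ∈ S → (7 : Fin 9) ∉ S → ∀ q : Fin 9, q ∉ S → q ≠ 7 →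
      0 ≤ ∑ s ∈ (univ : Finset (Fin 12)).powerset.filter (fun s : Finset (Fin 12) =>
          ¬ ((∃ a ∈ S, (7 : Fin 9) ∈ openCluster (ends₂ '' (↑s : Set (Fin 12))) a) ∧
              (∃ a ∈ S, (7 : Fin 9) ∈ openCluster (ends₂ '' (↑(univ \ s) : Set (Fin 12))) a)) ∧
            ((∃ a ∈ insert q S, (7 : Fin 9) ∈ openCluster (ends₂ '' (↑s : Set (Fin 12))) a) ∧
              (∃ a ∈ insert q S, (7 : Fin 9) ∈ openCluster (ends₂ '' (↑(univ \ s) : Set (Fin 12))) a))),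
        (pt 1 (openCluster (ends₂ '' (↑s : Set (Fin 12))) 0) - pt 1 (openCluster (ends₂ '' (↑(univ \ s) : Set (Fin 12))) 0)) *
          (pt 4 (openCluster (ends₂ '' (↑s : Set (Fin 12))) 0) - pt 4 (openCluster (ends₂ '' (↑(univ \ s) : Set (Fin 12))) 0))) := by
  intro h
  have h0 := h {0} (by decide) (by decide) 8 (by decide) (by decide)
  rw [stratum_sum_eq] at h0
  linarith

open Classical in
/-- **NO-CORE itself holds on witness 2**: its NO-CORE sum (shape of the conclusion of `noCore_of_inGadget`, `E = univ`) is `40`. -/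
theorem noCore_sum_eq :
    (∑ s ∈ (univ : Finset (Fin 12)).powerset.filter (fun s : Finset (Fin 12) => ¬ ((7 : Fin 9) ∈ openCluster (ends₂ '' (↑s : Set (Fin 12))) 0 ∧
          (7 : Fin 9) ∈ openCluster (ends₂ '' (↑(univ \ s) : Set (Fin 12))) 0)),
      (pt 1 (openCluster (ends₂ '' (↑s : Set (Fin 12))) 0) - pt 1 (openCluster (ends₂ '' (↑(univ \ s) : Set (Fin 12))) 0)) *
        (pt 4 (openCluster (ends₂ '' (↑s : Set (Fin 12))) 0) - pt 4 (openCluster (ends₂ '' (↑(univ \ s) : Set (Fin 12))) 0))) = 40 := by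
  have hbridge := cwRec_eq_sum EL₂ hEL₂ leaf₃ LEAF₃ HL₃ lE₂ (by decide) ∅ ∅ _ _ (inv_empty EL₂ hEL₂) (inv_empty EL₂ hEL₂)
  have hl : lE₂.toFinset = (univ : Finset (Fin 12)) := by decide
  rw [hl, cwRec₃] at hbridge
  rw [Finset.sum_filter]
  have hsum : ∀ s ∈ (univ : Finset (Fin 12)).powerset,
      (if ¬ ((7 : Fin 9) ∈ openCluster (ends₂ '' (↑s : Set (Fin 12))) 0 ∧ (7 : Fin 9) ∈ openCluster (ends₂ '' (↑(univ \ s) : Set (Fin 12))) 0) then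
        (pt 1 (openCluster (ends₂ '' (↑s : Set (Fin 12))) 0) - pt 1 (openCluster (ends₂ '' (↑(univ \ s) : Set (Fin 12))) 0)) *
          (pt 4 (openCluster (ends₂ '' (↑s : Set (Fin 12))) 0) - pt 4 (openCluster (ends₂ '' (↑(univ \ s) : Set (Fin 12))) 0))
        else 0) = LEAF₃ (∅ ∪ s) (∅ ∪ (univ \ s)) := by
    intro s _
    simp only [Finset.empty_union, LEAF₃, T₂]
    split_ifs <;> simp
  rw [Finset.sum_congr rfl hsum, ← hbridge]
  norm_num

end IGCex

end Coefficientwise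

end Summit.CriticalPhenomena.PercolationContinuityZ3.Theorems
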